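import Mathlib
import HarnessLib
import Summits.NavierStokesRegularity.NavierStokesRegularity.Theses.ImplosionDoor
import Summits.NavierStokesRegularity.NavierStokesRegularity.Theorems.ImplosionDoorPassiveRadialVorticityStubVorticityBound
import Summits.NavierStokesRegularity.NavierStokesRegularity.Theorems.ImplosionDoorPassiveRadialVorticityStubFarPastWashout

/-!
# `ImplosionDoor.PassiveRadialVorticity` (item stmt-NavierStokesRegularity-25305) — PROVED

**Statement (verbatim route decl).**  For a profile `v` of the route's Type-I ancient Oseen-mild class (rate
`‖v(t,x)‖ ≤ C/√(−t)`, continuous on the open slab `(−∞,0) × ℝ³`, unit-viscosity Oseen-mild between negative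
times, divergence-free slices) that is sphere-tangential (`⟪v(s,y), y⟫ = 0` for all `s < 0`, `y`), the radial
vorticity moment vanishes identically: `⟪curl v(s)(y), y⟫ = 0`.

PROOF = the composition `PassiveRadialVorticity_of` of the skeleton of record (line `birth`, planner ns-idea-6,
sha 7fb62332…) with its two registered stubs, both landed:
* `stub_vorticityBound` (`…PassiveRadialVorticityStubVorticityBound`): the class-uniform Type-I vorticity bound
  `‖curl v(s)‖ ≤ C′/(−s)` (KNSS smoothing in the class gauge);
* `stub_farPastWashout` (`…PassiveRadialVorticityStubFarPastWashout`): the χ-transport identity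
  `∂ₜχ = Δχ − v·∇χ` for `χ = ⟪curl v, y⟫` under tangency (`…ChiTransport`) and the far-past washout by
  Friedman's weak maximum principle in the Gaussian gauge (`…Washout`) give `|χ| ≤ δ` for every `δ > 0`.

HONEST FRAMING: crux K1 of the door route ImplosionDoor (rung N0-LocalTubeDoorImplosion) — a statement about
HYPOTHETICAL blow-up profiles (KNSS-type ancient mild solutions under the door hypotheses).  Nothing here proves
a Navier–Stokes regularity statement; no summit statement is proved.
-/

noncomputable section

-- the summit and its single sub-problem share the name (CONVENTIONS §1), as in every Theorems file
set_option linter.dupNamespace false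

namespace Summit.NavierStokesRegularity.NavierStokesRegularity.Theorems

open scoped RealInnerProductSpace InnerProductSpace
open Summit.NavierStokesRegularity.NavierStokesRegularity.Theorems.ImplosionDoorPassiveRadialVorticityStubVorticityBound
open Summit.NavierStokesRegularity.NavierStokesRegularity.Theorems.ImplosionDoorPassiveRadialVorticityStubFarPastWashout

/-- **Item stmt-NavierStokesRegularity-25305** (`ImplosionDoor.PassiveRadialVorticity`): for a sphere-tangential
Type-I ancient Oseen-mild divergence-free profile the radial vorticity moment `⟪curl v(s)(y), y⟫` vanishes
identically (`stub_vorticityBound` + `stub_farPastWashout`: `|⟪curl v(s)(y), y⟫| ≤ δ` for all `δ > 0`).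
[cite: KochNadirashviliSereginSverak2009, Prop. 4.1; Friedman1964, Ch. 2 §4 Lemma 5; folklore] -/
theorem implosionDoor_passiveRadialVorticity_proof :
    Summit.NavierStokesRegularity.NavierStokesRegularity.Theses.ImplosionDoor.PassiveRadialVorticity := by
  unfold Summit.NavierStokesRegularity.NavierStokesRegularity.Theses.ImplosionDoor.PassiveRadialVorticity
  intro C v hd hc hm hdiv htan s hs y
  obtain ⟨C', hC'⟩ := stub_vorticityBound C v hd hc hm hdiv
  have hδ := stub_farPastWashout C v hd hc hm hdiv htan C' hC' s hs y
  have habs : |⟪Literature.Analysis.FluidPDE.curl (v s) y, y⟫_ℝ| ≤ 0 := by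
    apply le_of_forall_pos_le_add
    intro ε hε
    simpa using hδ ε hε
  exact abs_eq_zero.mp (le_antisymm habs (abs_nonneg _))

end Summit.NavierStokesRegularity.NavierStokesRegularity.Theorems

end
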